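import Literature.Topology.FourManifolds.RegularLevelMorseData
import Literature.Topology.FourManifolds.TrisectionsTubeModel
import HarnessLib

/-!
# The germ of the Heegaard function about the attaching link: Morse data on the level

Topic `Literature/Topology/FourManifolds`; step D1 of a Morse-theoretic construction of
Gay–Kirby's trisection for the fact seat
`provefact-Literature.Topology.FourManifolds.exists_isBalancedGKTrisection` (Gay–Kirby 2016,
Thm. 4 via §4, Lemma 14).  Everything in this file is **proved**; no definitions, no named
facts.

Setting: a `4`-manifold `M`, a smooth function `f` with a regular level `Y = f⁻¹(a)`
(`Literature.Topology.FourManifolds.RegularLevel`), a chart `e` of the maximal atlas about a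
point `c` in which `f = f(c) + Q₂(e - e c)`, `Q₂ = -|x|² + |y|²` — Milnor's coordinates about a
critical point of index `2` (*Lectures on the h-cobordism theorem* (1965), Def. 3.1;
`IsGradientLike.exists_chart_morseIndex`) — with `a < f(c)`, so that `Y` meets the chart in
the level `{|x|² = (f c - a) + |y|²}` through the attaching circle `{y = 0}` of the `2`-handle,
and a function `F` on `M` whose germ at a point `p ∈ Y` of the chart is the **tube function**
`𝒯(e - e c)`, `𝒯(x, y) = 1 - ε x₀²/|x|² + (κ/η)|x|²|y|²` (`TrisectionsTubeModel.lean`).  Then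
(`RegularLevelMorseData.lean` + the model computations):

* `HeegaardGerm.isMCriticalPt_comp_incl_iff` — `p` is a critical point of the Heegaard germ
  `F|Y` iff `e p - e c` lies on `{y = 0, x₀ x₁ = 0}`, i.e. `p` is one of the four points
  `θ ∈ {0, π/2, π, 3π/2}` of the attaching circle (the tube function is a first integral of
  Milnor's field, which is transverse to the level);
* `HeegaardGerm.nondegenerate_and_morseIndex_eq_zero/one` — these critical points are
  nondegenerate, of index `0` at `θ ∈ {0, π}` and of index `1` at `θ = ±π/2`.

This is the explicit standard piece of the Heegaard function of Gay–Kirby's Lemma 14 near the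
attaching link `L` of the `2`-handles (there: a Morse function on `∂X₁` which near each
component of `L` is the height on the circle plus the distance squared from it, so that `L` is
a union of closures of descending arcs of index-`1` points lying in the Heegaard surface).

## References

* D. Gay, R. Kirby, *Trisecting 4-manifolds*, Geom. Topol. 20 (2016), §4, Lemma 14 and proof
  of Thm. 4. [GayKirby2016]
* J. Milnor, *Lectures on the h-cobordism theorem* (1965), Def. 3.1. [MilnorHCobordism1965]
* J. Milnor, *Morse theory* (1963), §2. [Milnor1963]
-/

open scoped Manifold ContDiff Topology
open Set Function Filter

noncomputable section

universe u

namespace Literature.Topology.FourManifolds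

/-- Local notation: `𝔼 n` is the model Euclidean space `EuclideanSpace ℝ (Fin n)`. -/
local notation "𝔼 " n:arg => EuclideanSpace ℝ (Fin n)

namespace HeegaardGerm

open RadialThickening (proj)
open TubeModel

variable {M : Type u} [TopologicalSpace M] [ChartedSpace (𝔼 4) M] [IsManifold (𝓡 4) ∞ M]
  {f : M → ℝ} {a : ℝ} {h : IsRegularLevel (𝓡 4) f a}
  {e : OpenPartialHomeomorph M (𝔼 4)} {c : M} {F : M → ℝ} {ε κ η : ℝ}

/-! ### The two functions read in the Milnor chart -/

omit [ChartedSpace (𝔼 4) M] [IsManifold (𝓡 4) ∞ M] in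
/-- In Milnor's chart, `f ∘ e⁻¹ = f(c) + Q₂(· - e c)` near every point of the chart.
[cite: MilnorHCobordism1965, Def. 3.1] -/
theorem comp_symm_eventuallyEq_milnorQuadratic
    (hfe : ∀ q ∈ e.source, f q = f c + milnorQuadratic 2 (e q - e c)) {x : M} (hx : x ∈ e.source) :
    f ∘ e.symm =ᶠ[𝓝 (e x)] fun w => f c + milnorQuadratic 2 (w - e c) := by
  filter_upwards [e.open_target.mem_nhds (e.map_source hx)] with w hw
  rw [comp_apply, hfe _ (e.map_target hw), e.right_inv hw]

omit [ChartedSpace (𝔼 4) M] [IsManifold (𝓡 4) ∞ M] in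
/-- If `F` has the germ of `𝒯(e - e c)` at `x`, then `F ∘ e⁻¹` has the germ of `𝒯(· - e c)` at
`e x`. [folklore] -/
theorem comp_symm_eventuallyEq_tube {x : M} (hx : x ∈ e.source)
    (hF : F =ᶠ[𝓝 x] fun q => tube ε κ η (e q - e c)) :
    F ∘ e.symm =ᶠ[𝓝 (e x)] fun w => tube ε κ η (w - e c) := by
  have h1 : ContinuousAt e.symm (e x) := e.continuousAt_symm (e.map_source hx)
  have h2 : ∀ᶠ w in 𝓝 (e x), F (e.symm w) = tube ε κ η (e (e.symm w) - e c) := by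
    have : ∀ᶠ q in 𝓝 (e.symm (e x)), F q = tube ε κ η (e q - e c) := by rwa [e.left_inv hx]
    exact h1.eventually this
  filter_upwards [h2, e.open_target.mem_nhds (e.map_source hx)] with w hw hw'
  rw [comp_apply, hw, e.right_inv hw']

omit [IsManifold (𝓡 4) ∞ M] in
/-- **On the level below `f(c)` the core coordinates do not vanish**: for `p ∈ Y = f⁻¹(a)` in
the chart and `a < f(c)`, `Q₂(e p - e c) = a - f(c) < 0`, so `|x(p)|² > 0`.
[cite: MilnorHCobordism1965, Def. 3.1] -/
theorem nsq_proj_ne_zero (hfe : ∀ q ∈ e.source, f q = f c + milnorQuadratic 2 (e q - e c))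
    (ha : a < f c) (p : RegularLevel h) (hpe : p.1 ∈ e.source) :
    nsq (proj (e p.1 - e c)) ≠ 0 := by
  refine nsq_proj_ne_zero_of_milnorQuadratic_neg ?_
  have hp : f p.1 = a := p.2
  have := hfe p.1 hpe
  linarith

omit [IsManifold (𝓡 4) ∞ M] in
/-- The tube germ `q ↦ 𝒯(e q - e c)` is smooth at the points of the chart with `x ≠ 0`.
[folklore] -/
theorem contMDiffAt_tube_comp (he : e ∈ IsManifold.maximalAtlas (𝓡 4) ∞ M)
    {x : M} (hx : x ∈ e.source) (hz : nsq (proj (e x - e c)) ≠ 0) :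
    ContMDiffAt (𝓡 4) 𝓘(ℝ, ℝ) ∞ (fun q => tube ε κ η (e q - e c)) x := by
  have h1 : ContMDiffAt (𝓡 4) (𝓡 4) ∞ e x :=
    (contMDiffOn_of_mem_maximalAtlas he).contMDiffAt (e.open_source.mem_nhds hx)
  have h2 : ContMDiffAt (𝓡 4) 𝓘(ℝ, 𝔼 4) ∞ (fun q => e q - e c) x := h1.sub contMDiffAt_const
  exact (contDiffAt_tube ε κ η hz).contMDiffAt.comp x h2

omit [IsManifold (𝓡 4) ∞ M] in
/-- A function with the tube germ at `x` is smooth at `x`. [folklore] -/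
theorem contMDiffAt_of_eventuallyEq (he : e ∈ IsManifold.maximalAtlas (𝓡 4) ∞ M)
    {x : M} (hx : x ∈ e.source) (hz : nsq (proj (e x - e c)) ≠ 0)
    (hF : F =ᶠ[𝓝 x] fun q => tube ε κ η (e q - e c)) :
    ContMDiffAt (𝓡 4) 𝓘(ℝ, ℝ) ∞ F x :=
  (contMDiffAt_tube_comp he hx hz).congr_of_eventuallyEq hF

/-! ### Critical points -/

/-- **Ambient critical points of the tube germ**: `F` is critical at `x` iff `e x - e c` lies
on `{y = 0, x₀ x₁ = 0}`. [cite: GayKirby2016, §4, Lemma 14] -/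
theorem isMCriticalPt_iff (he : e ∈ IsManifold.maximalAtlas (𝓡 4) ∞ M) (hε : ε ≠ 0)
    (hκ : κ / η ≠ 0) {x : M} (hx : x ∈ e.source) (hz : nsq (proj (e x - e c)) ≠ 0)
    (hF : F =ᶠ[𝓝 x] fun q => tube ε κ η (e q - e c)) :
    IsMCriticalPt (𝓡 4) F x ↔
      (e x - e c) 2 = 0 ∧ (e x - e c) 3 = 0 ∧ (e x - e c) 0 * (e x - e c) 1 = 0 := by
  have hFc : ContMDiffAt (𝓡 4) 𝓘(ℝ, ℝ) ∞ F x := contMDiffAt_of_eventuallyEq he hx hz hF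
  rw [isMCriticalPt_iff_fderiv_comp_symm_eq_zero (contMDiffOn_of_mem_maximalAtlas he)
    (contMDiffOn_symm_of_mem_maximalAtlas he) hx (hFc.mdifferentiableAt (by simp)),
    (comp_symm_eventuallyEq_tube hx hF).fderiv_eq, fderiv_comp_sub,
    fderiv_tube_eq_zero_iff hε hκ hz]

/-- **Critical points of the Heegaard germ on the level**: for `p ∈ Y = f⁻¹(a)` in Milnor's
chart (`a < f c`), `F|Y` is critical at `p` iff `e p - e c` lies on `{y = 0, x₀ x₁ = 0}` — the
four points `θ ∈ {0, π/2, π, 3π/2}` of the attaching circle `{y = 0, |x|² = f(c) - a}` — iff `F`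
itself is critical at `p` (the tube function is a first integral of Milnor's field `ξ`, and
`ξ` is transverse to the level). [cite: GayKirby2016, §4, Lemma 14] -/
theorem isMCriticalPt_comp_incl_iff (he : e ∈ IsManifold.maximalAtlas (𝓡 4) ∞ M)
    (hfe : ∀ q ∈ e.source, f q = f c + milnorQuadratic 2 (e q - e c)) (ha : a < f c)
    (hε : ε ≠ 0) (hκ : κ / η ≠ 0) (p : RegularLevel h) (hpe : p.1 ∈ e.source)
    (hF : F =ᶠ[𝓝 p.1] fun q => tube ε κ η (e q - e c)) :
    IsMCriticalPt (𝓡 3) (F ∘ RegularLevel.incl h) p ↔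
      (e p.1 - e c) 2 = 0 ∧ (e p.1 - e c) 3 = 0 ∧ (e p.1 - e c) 0 * (e p.1 - e c) 1 = 0 := by
  have hz := nsq_proj_ne_zero hfe ha p hpe
  have hFc : ContMDiffAt (𝓡 4) 𝓘(ℝ, ℝ) 2 F p.1 :=
    (contMDiffAt_of_eventuallyEq he hpe hz hF).of_le (by norm_cast)
  rw [RegularLevel.isMCriticalPt_comp_incl_iff_of_chart p hFc he hpe]
  have hfev := (comp_symm_eventuallyEq_milnorQuadratic hfe hpe).fderiv_eq (𝕜 := ℝ)
  have hFev := (comp_symm_eventuallyEq_tube hpe hF).fderiv_eq (𝕜 := ℝ)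
  rw [hfev, hFev, forall_fderiv_tube_sub_eq_zero_iff ε κ η (f c) (e c) hz, fderiv_comp_sub,
    fderiv_tube_eq_zero_iff hε hκ hz]

/-- On the level, `F|Y` is critical at `p` iff `F` is. [cite: GayKirby2016, §4, Lemma 14] -/
theorem isMCriticalPt_comp_incl_iff_isMCriticalPt (he : e ∈ IsManifold.maximalAtlas (𝓡 4) ∞ M)
    (hfe : ∀ q ∈ e.source, f q = f c + milnorQuadratic 2 (e q - e c)) (ha : a < f c)
    (hε : ε ≠ 0) (hκ : κ / η ≠ 0) (p : RegularLevel h) (hpe : p.1 ∈ e.source)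
    (hF : F =ᶠ[𝓝 p.1] fun q => tube ε κ η (e q - e c)) :
    IsMCriticalPt (𝓡 3) (F ∘ RegularLevel.incl h) p ↔ IsMCriticalPt (𝓡 4) F p.1 := by
  rw [isMCriticalPt_comp_incl_iff he hfe ha hε hκ p hpe hF,
    isMCriticalPt_iff he hε hκ hpe (nsq_proj_ne_zero hfe ha p hpe) hF]

/-! ### Nondegeneracy and indices at the four points -/

omit [ChartedSpace (𝔼 4) M] [IsManifold (𝓡 4) ∞ M] in
/-- The tangent hyperplane of the level read in Milnor's chart: `ker D(f ∘ e⁻¹)(e p)` is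
`ker DQ₂(e p - e c)`. [cite: LeeSmoothManifolds2013, Prop. 5.38] -/
theorem mem_ker_fderiv_iff (hfe : ∀ q ∈ e.source, f q = f c + milnorQuadratic 2 (e q - e c))
    {x : M} (hx : x ∈ e.source) (v : 𝔼 4) :
    v ∈ LinearMap.ker (fderiv ℝ (f ∘ e.symm) (e x) : 𝔼 4 →ₗ[ℝ] ℝ) ↔
      fderiv ℝ (milnorQuadratic (m := 4) 2) (e x - e c) v = 0 := by
  rw [LinearMap.mem_ker, ContinuousLinearMap.coe_coe,
    (comp_symm_eventuallyEq_milnorQuadratic hfe hx).fderiv_eq, fderiv_const_add_milnorQuadratic_sub,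
    fderiv_milnorQuadratic]

omit [ChartedSpace (𝔼 4) M] [IsManifold (𝓡 4) ∞ M] in
/-- The Hessian of `F` read in Milnor's chart is `D²𝒯(e p - e c)`. [cite: Milnor1963, §2] -/
theorem hessianInChart_apply {x : M} (hx : x ∈ e.source)
    (hF : F =ᶠ[𝓝 x] fun q => tube ε κ η (e q - e c)) (v w : 𝔼 4) :
    hessianInChart (𝓡 4) e F x v w = fderiv ℝ (fderiv ℝ (tube ε κ η)) (e x - e c) v w := by
  rw [RegularLevel.hessianInChart_apply_eq, ((comp_symm_eventuallyEq_tube hx hF).fderiv).fderiv_eq,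
    fderiv_fderiv_comp_sub_const]

/-- **Index `0` at `θ ∈ {0, π}`**: at a point `p ∈ Y` of the chart with `e p - e c = (±r, 0, 0, 0)`
the Heegaard germ `F|Y` has a nondegenerate critical point of index `0` (`ε, κ/η > 0`): its
Hessian is congruent to `(2ε/r²) v₁² + (2κr²/η)(v₂² + v₃²)` on `{v₀ = 0}`.
[cite: GayKirby2016, §4, Lemma 14] [cite: Milnor1963, §2] -/
theorem nondegenerate_and_morseIndex_eq_zero (he : e ∈ IsManifold.maximalAtlas (𝓡 4) ∞ M)
    (hfe : ∀ q ∈ e.source, f q = f c + milnorQuadratic 2 (e q - e c)) (ha : a < f c)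
    (hε : 0 < ε) (hκ : 0 < κ / η) (p : RegularLevel h) (hpe : p.1 ∈ e.source)
    (hF : F =ᶠ[𝓝 p.1] fun q => tube ε κ η (e q - e c))
    (h0 : (e p.1 - e c) 0 ≠ 0) (h1 : (e p.1 - e c) 1 = 0) (h2 : (e p.1 - e c) 2 = 0)
    (h3 : (e p.1 - e c) 3 = 0) :
    (mhessian (𝓡 3) (F ∘ RegularLevel.incl h) p).Nondegenerate ∧
      morseIndex (𝓡 3) (F ∘ RegularLevel.incl h) p = 0 := by
  have hz := nsq_proj_ne_zero hfe ha p hpe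
  have hFc : ContMDiffAt (𝓡 4) 𝓘(ℝ, ℝ) 2 F p.1 :=
    (contMDiffAt_of_eventuallyEq he hpe hz hF).of_le (by norm_cast)
  have hp : IsMCriticalPt (𝓡 4) F p.1 :=
    (isMCriticalPt_iff he hε.ne' hκ.ne' hpe hz hF).2 ⟨h2, h3, by rw [h1, mul_zero]⟩
  rw [RegularLevel.nondegenerate_mhessian_comp_incl_iff p hFc hp he hpe,
    RegularLevel.morseIndex_comp_incl_eq p hFc hp he hpe]
  have h0' : 0 < (e p.1 - e c) 0 ^ 2 := by positivity
  refine nondegenerate_and_sigNeg_eq_zero_of_apply_eq (a := 2 * ε / (e p.1 - e c) 0 ^ 2)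
    (b := 2 * (κ / η * (e p.1 - e c) 0 ^ 2)) (by positivity) (by positivity) (fun v w => ?_)
    (fun v => ?_)
  · rw [hessianInChart_apply hpe hF, fderiv_fderiv_tube_apply_of_eq_zero_one ε κ η h0 h1 h2 h3]
  · rw [mem_ker_fderiv_iff hfe hpe, fderiv_milnorQuadratic_two_eq_zero_iff_of_axis₀ h0 h1 h2 h3]

/-- **Index `1` at `θ = ±π/2`**: at a point `p ∈ Y` of the chart with `e p - e c = (0, ±r, 0, 0)`
the Heegaard germ `F|Y` has a nondegenerate critical point of index `1` (`ε, κ/η > 0`): its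
Hessian is congruent to `-(2ε/r²) v₀² + (2κr²/η)(v₂² + v₃²)` on `{v₁ = 0}`.
[cite: GayKirby2016, §4, Lemma 14] [cite: Milnor1963, §2] -/
theorem nondegenerate_and_morseIndex_eq_one (he : e ∈ IsManifold.maximalAtlas (𝓡 4) ∞ M)
    (hfe : ∀ q ∈ e.source, f q = f c + milnorQuadratic 2 (e q - e c)) (ha : a < f c)
    (hε : 0 < ε) (hκ : 0 < κ / η) (p : RegularLevel h) (hpe : p.1 ∈ e.source)
    (hF : F =ᶠ[𝓝 p.1] fun q => tube ε κ η (e q - e c))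
    (h0 : (e p.1 - e c) 0 = 0) (h1 : (e p.1 - e c) 1 ≠ 0) (h2 : (e p.1 - e c) 2 = 0)
    (h3 : (e p.1 - e c) 3 = 0) :
    (mhessian (𝓡 3) (F ∘ RegularLevel.incl h) p).Nondegenerate ∧
      morseIndex (𝓡 3) (F ∘ RegularLevel.incl h) p = 1 := by
  have hz := nsq_proj_ne_zero hfe ha p hpe
  have hFc : ContMDiffAt (𝓡 4) 𝓘(ℝ, ℝ) 2 F p.1 :=
    (contMDiffAt_of_eventuallyEq he hpe hz hF).of_le (by norm_cast)
  have hp : IsMCriticalPt (𝓡 4) F p.1 :=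
    (isMCriticalPt_iff he hε.ne' hκ.ne' hpe hz hF).2 ⟨h2, h3, by rw [h0, zero_mul]⟩
  rw [RegularLevel.nondegenerate_mhessian_comp_incl_iff p hFc hp he hpe,
    RegularLevel.morseIndex_comp_incl_eq p hFc hp he hpe]
  have h1' : 0 < (e p.1 - e c) 1 ^ 2 := by positivity
  refine nondegenerate_and_sigNeg_eq_one_of_apply_eq (a := 2 * ε / (e p.1 - e c) 1 ^ 2)
    (b := 2 * (κ / η * (e p.1 - e c) 1 ^ 2)) (by positivity) (by positivity) (fun v w => ?_)
    (fun v => ?_)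
  · rw [hessianInChart_apply hpe hF, fderiv_fderiv_tube_apply_of_eq_zero_zero ε κ η h0 h1 h2 h3]
  · rw [mem_ker_fderiv_iff hfe hpe, fderiv_milnorQuadratic_two_eq_zero_iff_of_axis₁ h0 h1 h2 h3]

omit [ChartedSpace (𝔼 4) M] [IsManifold (𝓡 4) ∞ M] in
/-- **Values at the four points**: `F(p) = 1 - ε` at `θ ∈ {0, π}` and `F(p) = 1` at
`θ = ±π/2`. [cite: GayKirby2016, §4, Lemma 14] -/
theorem apply_eq_of_axis₀ {x : M} (hF : F =ᶠ[𝓝 x] fun q => tube ε κ η (e q - e c))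
    (h0 : (e x - e c) 0 ≠ 0) (h1 : (e x - e c) 1 = 0) (h2 : (e x - e c) 2 = 0)
    (h3 : (e x - e c) 3 = 0) : F x = 1 - ε := by
  rw [hF.eq_of_nhds, tube_apply_of_axis₀ ε κ η h0 h1 h2 h3]

omit [ChartedSpace (𝔼 4) M] [IsManifold (𝓡 4) ∞ M] in
/-- `F(p) = 1` at `θ = ±π/2`. [cite: GayKirby2016, §4, Lemma 14] -/
theorem apply_eq_of_axis₁ {x : M} (hF : F =ᶠ[𝓝 x] fun q => tube ε κ η (e q - e c))
    (h0 : (e x - e c) 0 = 0) (h2 : (e x - e c) 2 = 0) (h3 : (e x - e c) 3 = 0) : F x = 1 := by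
  rw [hF.eq_of_nhds, tube_apply_of_axis₁ ε κ η h0 h2 h3]

end HeegaardGerm

end Literature.Topology.FourManifolds

end
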